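import Summits.Ventures.Crystal3D.StickySpheres.EightCensusMinThree
import Summits.Ventures.Crystal3D.StickySpheres.EightCensusMinFour
import Summits.Ventures.Crystal3D.StickySpheres.NineVertexBridge
import Summits.Ventures.Crystal3D.StickySpheres.Open8B
import Summits.Ventures.Crystal3D.StickySpheres.Open8L
import HarnessLib

/-!
# The complete list `L(8,18)` is a theorem; `C(9) = 21` from the single pattern `Nine22B`

Venture `Crystal3D` (cell `pub-crystal3d`, seat p2). Assembly of `ineq/FORMAL-C9.md` §7. Seat p3 reduced the row `n = 9` of the
contact-number table to the COMPLETE-LIST statement `CompleteListHypothesis 3 18 8 (tableSet 8 L18rows)` (every relaxed-realisable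
graph on `8` vertices with `18` edges and minimum degree `≥ 3` is one of the `13` contact graphs of the `18`-contact packings of
`8` balls; `NineVertexCones.lean`) and ONE nine-vertex pattern (`NineVertexBridge.lean`: `maxContacts_three_nine_of_L18_N9A`,
`not_relaxedRealisable_N9A_of_no_Nine22B`). This file PROVES the complete-list statement:

* glue `coversB` / `nonempty_iso_tableGraph_of_coversB`: an injective map sending the pairs of an `e`-pair edge list onto edges
  of an `e`-edge graph `G`, where the list covers an `e`-edge row-bitmask table, is an isomorphism of `G` onto p3's table graph
  (kernel-evaluated Boolean certificate);
* **`completeList_L18 : CompleteListHypothesis 3 18 8 (tableSet 8 L18rows)`** — UNCONDITIONAL: a degree-3 vertex ⇒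
  `EightCensus3.eight_census_deg_three` (one of the twelve graphs `R8`), all degrees `≥ 4` ⇒ `EightCensus.eight_census_minDeg_four`
  (the snub disphenoid); their pattern hypotheses are the theorems `no_Open8B` (`Open8B.lean`, reflection-rule proof) and
  `no_Open8L` (`Open8L.lean`, seven-ball sub-pattern + LP certificate);
* corollaries through p3's bridge: `graphStratum_nine_of_no_Nine22B`, **`maxContacts_three_nine_of_no_Nine22B`** (`C(9) = 21`) and
  `maxContacts_three_twelve_of_no_Nine22B` (`C(12) = 33`, with p3's lists `L21d4`, `L(10,25)`, `L(10,24)`), each conditional on the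
  single pattern statement `Nine22B` (the cone over the snub disphenoid on its four degree-4 vertices; exact degree-4 SOS
  certificates exist for it and for its eight-ball sub-pattern, `ineq/enum9/certs/`, no Lean replay yet).

HONEST FRAMING: finite combinatorics and bookkeeping over the cell's landed lemmas; nothing about crystallization.
-/

namespace Summit.Ventures.Crystal3D

open Finset SimpleGraph

/-! ### 1. Glue: edge lists versus row-bitmask tables -/

section Glue

variable {m : ℕ}

/-- Covering certificate: the table `rows` is a valid graph table with `e` edges (row-degree sum `2e`) and every table
adjacency `a ~ b` is a listed pair, `(a, b) ∈ E` or `(b, a) ∈ E`. [folklore] -/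
def coversB (e : ℕ) (rows : List ℕ) (E : List (Fin m × Fin m)) : Bool :=
  symmB (adjOfRows rows : Fin m → Fin m → Bool) && irreflB (adjOfRows rows : Fin m → Fin m → Bool) &&
    decide (((List.finRange m).map (rowDeg (adjOfRows rows : Fin m → Fin m → Bool))).sum = 2 * e) &&
    (List.finRange m).all fun a => (List.finRange m).all fun b =>
      !(adjOfRows rows a b) || decide ((a, b) ∈ E) || decide ((b, a) ∈ E)

/-- **Containment with the right edge count is isomorphism.** If `E` covers the `e`-edge table `rows`, `G` has exactly
`e` edges and an injective `f` sends every pair of `E` to an edge of `G`, then `G` is isomorphic to the table graph.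
[folklore] -/
theorem nonempty_iso_tableGraph_of_coversB {e : ℕ} {rows : List ℕ} {E : List (Fin m × Fin m)}
    (hc : coversB e rows E = true) (G : SimpleGraph (Fin m)) [DecidableRel G.Adj] (hcard : G.edgeFinset.card = e)
    {f : Fin m → Fin m} (hf : Function.Injective f) (hsub : ∀ p ∈ E, G.Adj (f p.1) (f p.2)) :
    Nonempty (G ≃g tableGraph m rows) := by
  classical
  simp only [coversB, Bool.and_eq_true, decide_eq_true_eq, List.all_eq_true, List.mem_finRange, true_implies,
    Bool.or_eq_true, Bool.not_eq_true'] at hc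
  obtain ⟨⟨⟨hs, hl⟩, hsum⟩, hcov⟩ := hc
  rw [tableGraph_eq hs hl]
  set H := boolGraph (adjOfRows rows) (symm_of_symmB hs) (irrefl_of_irreflB hl) with hH
  let σ : Fin m ≃ Fin m := Equiv.ofBijective f (Finite.injective_iff_bijective.1 hf)
  have hle : H ≤ G.comap (σ : Fin m → Fin m) := by
    intro a b hab
    rw [hH, boolGraph_adj] at hab
    rw [comap_adj]
    rcases hcov a b with (h | h) | h
    · rw [h] at hab
      exact absurd hab Bool.false_ne_true
    · exact hsub _ h
    · exact (hsub _ h).symm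
  have h1 : (G.comap (σ : Fin m → Fin m)).edgeFinset.card = e := by
    rw [← hcard]
    exact (SimpleGraph.Iso.comap σ G).card_edgeFinset_eq
  have h2 : H.edgeFinset.card = e := by
    have h := two_mul_card_edgeFinset_boolGraph (adjOfRows rows) (symm_of_symmB hs) (irrefl_of_irreflB hl)
    have h' := card_edgeFinset_congr_of_eq hH
    omega
  have heq : H = G.comap (σ : Fin m → Fin m) := by
    have hsubF : H.edgeFinset ⊆ (G.comap (σ : Fin m → Fin m)).edgeFinset := edgeFinset_subset_edgeFinset.2 hle
    exact edgeFinset_inj.1 (Finset.eq_of_subset_of_card_le hsubF (by rw [h1, h2]))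
  exact ⟨((isoOfEq heq).trans (SimpleGraph.Iso.comap σ G)).symm⟩

/-- The `k`-th table graph is a member of the table set. [folklore] -/
theorem tableGraph_mem_tableSet (tabs : List (List ℕ)) (k : ℕ) (hk : k < tabs.length) :
    tableGraph m (tabs.getD k []) ∈ tableSet m tabs :=
  show ∃ k', k' < tabs.length ∧ tableGraph m (tabs.getD k []) = tableGraph m (tabs.getD k' []) from ⟨k, hk, rfl⟩

end Glue

/-! ### 2. The complete list `L(8,18)` -/

/-- **`L(8,18)` is complete.** Every relaxed-realisable graph on `Fin 8` with `18` edges and minimum degree `≥ 3` is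
isomorphic to one of the `13` contact graphs `L18rows` of the `18`-contact packings of `8` balls. A vertex of degree `3` ⇒
`EightCensus3.eight_census_deg_three` (one of the twelve graphs `R8`, tables `0, 2, …, 12`); all degrees `≥ 4` ⇒
`EightCensus.eight_census_minDeg_four` (the snub disphenoid, table `1`); the pattern hypotheses of those theorems are
`no_Open8B` and `no_Open8L`; containment is isomorphism by `nonempty_iso_tableGraph_of_coversB`. [folklore] -/
theorem completeList_L18 : CompleteListHypothesis 3 18 8 (tableSet 8 L18rows) := by
  intro G _ hcard hdeg hreal
  by_cases h3 : ∃ w, G.degree w = 3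
  · obtain ⟨w, hw⟩ := h3
    obtain ⟨f, hf, r, hr⟩ := EightCensus3.eight_census_deg_three no_Open8B G hcard hdeg w hw hreal
    cases r with
    | r01 =>
      exact ⟨_, tableGraph_mem_tableSet L18rows 0 (by decide),
        nonempty_iso_tableGraph_of_coversB (by decide) G hcard hf hr⟩
    | r03 =>
      exact ⟨_, tableGraph_mem_tableSet L18rows 2 (by decide),
        nonempty_iso_tableGraph_of_coversB (by decide) G hcard hf hr⟩
    | r04 =>
      exact ⟨_, tableGraph_mem_tableSet L18rows 3 (by decide),
        nonempty_iso_tableGraph_of_coversB (by decide) G hcard hf hr⟩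
    | r05 =>
      exact ⟨_, tableGraph_mem_tableSet L18rows 4 (by decide),
        nonempty_iso_tableGraph_of_coversB (by decide) G hcard hf hr⟩
    | r06 =>
      exact ⟨_, tableGraph_mem_tableSet L18rows 5 (by decide),
        nonempty_iso_tableGraph_of_coversB (by decide) G hcard hf hr⟩
    | r07 =>
      exact ⟨_, tableGraph_mem_tableSet L18rows 6 (by decide),
        nonempty_iso_tableGraph_of_coversB (by decide) G hcard hf hr⟩
    | r08 =>
      exact ⟨_, tableGraph_mem_tableSet L18rows 7 (by decide),
        nonempty_iso_tableGraph_of_coversB (by decide) G hcard hf hr⟩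
    | r09 =>
      exact ⟨_, tableGraph_mem_tableSet L18rows 8 (by decide),
        nonempty_iso_tableGraph_of_coversB (by decide) G hcard hf hr⟩
    | r10 =>
      exact ⟨_, tableGraph_mem_tableSet L18rows 9 (by decide),
        nonempty_iso_tableGraph_of_coversB (by decide) G hcard hf hr⟩
    | r11 =>
      exact ⟨_, tableGraph_mem_tableSet L18rows 10 (by decide),
        nonempty_iso_tableGraph_of_coversB (by decide) G hcard hf hr⟩
    | r12 =>
      exact ⟨_, tableGraph_mem_tableSet L18rows 11 (by decide),
        nonempty_iso_tableGraph_of_coversB (by decide) G hcard hf hr⟩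
    | r13 =>
      exact ⟨_, tableGraph_mem_tableSet L18rows 12 (by decide),
        nonempty_iso_tableGraph_of_coversB (by decide) G hcard hf hr⟩
  · push Not at h3
    have hdeg4 : ∀ i, 4 ≤ G.degree i := fun i => by
      have h1 := hdeg i
      have h2 := h3 i
      omega
    obtain ⟨f, hf, hs⟩ := EightCensus.eight_census_minDeg_four no_Open8L G hcard hdeg4 hreal
    exact ⟨_, tableGraph_mem_tableSet L18rows 1 (by decide),
      nonempty_iso_tableGraph_of_coversB (by decide) G hcard hf hs⟩

/-! ### 3. The row `n = 9` from the single pattern `Nine22B` -/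

/-- **`GSH(4, 22, 9)` from the pattern `Nine22B` alone** (through p3's `graphStratum_nine_of_L18_N9A`). [folklore] -/
theorem graphStratum_nine_of_no_Nine22B
    (hN : ∀ p : Fin 9 → EuclideanSpace ℝ (Fin 3), (∀ e ∈ Nine22BEdges, dist (p e.1) (p e.2) = 1) →
      (∀ i j : Fin 9, i ≠ j → 1 ≤ dist (p i) (p j)) → False) :
    GraphStratumHypothesis 4 22 9 :=
  graphStratum_nine_of_L18_N9A completeList_L18 (not_relaxedRealisable_N9A_of_no_Nine22B hN)

/-- **`C(9) = 21` from the pattern `Nine22B` alone**: if no nine points of `ℝ³` with pairwise distances `≥ 1` realise the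
`22` unit distances of `Nine22BEdges` (the cone over the snub disphenoid on its four degree-4 vertices), then
`maxContacts 3 9 = 21`. [folklore] -/
theorem maxContacts_three_nine_of_no_Nine22B
    (hN : ∀ p : Fin 9 → EuclideanSpace ℝ (Fin 3), (∀ e ∈ Nine22BEdges, dist (p e.1) (p e.2) = 1) →
      (∀ i j : Fin 9, i ≠ j → 1 ≤ dist (p i) (p j)) → False) :
    maxContacts 3 9 = 21 :=
  maxContacts_three_nine_of_L18_N9A completeList_L18 (not_relaxedRealisable_N9A_of_no_Nine22B hN)

/-- **`C(12) = 33`** from the pattern `Nine22B` and p3's complete lists `L21d4`, `L(10,25)`, `L(10,24)`. [folklore] -/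
theorem maxContacts_three_twelve_of_no_Nine22B
    (hN : ∀ p : Fin 9 → EuclideanSpace ℝ (Fin 3), (∀ e ∈ Nine22BEdges, dist (p e.1) (p e.2) = 1) →
      (∀ i j : Fin 9, i ≠ j → 1 ≤ dist (p i) (p j)) → False)
    (h21 : L21d4Complete) (h25 : CompleteListHypothesis 3 25 10 (tableSet 10 L25rows))
    (h24 : CompleteListHypothesis 3 24 10 (tableSet 10 L24rows)) : maxContacts 3 12 = 33 :=
  maxContacts_three_twelve_of_completeLists_N9A completeList_L18 (not_relaxedRealisable_N9A_of_no_Nine22B hN) h21 h25 h24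

end Summit.Ventures.Crystal3D
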